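import Mathlib

/-!
# SoloBlind — Chebyshev envelope of a kernel box (kernel #182)

E1-lite, Chebyshev basis (paper §24.105, ATTEMPTS A331): on a parameter box `|P - P_c| ≤ s` the
loop kernel is carried as a truncated Chebyshev sum `Σ_{m<N} c_m T_m(x)`, `x = (P - P_c)/s`, plus a
transported error.  Since `|T_m(x)| ≤ 1` on `[-1, 1]` (Mathlib: `abs_eval_T_real_le_one`), the
pointwise envelope of the main term is `Σ_{m<N} ‖c_m‖`, uniformly on the box — the Chebyshev
analogue of the Taylor envelope of kernel #180, without the geometric weights `s^n` that made the
monomial basis fail (Taylor radius ≈ holomorphy strip ≈ box half-width).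
-/

namespace Summit.AnomalousDissipation.AnomalousDissipation.Theorems

open Polynomial Polynomial.Chebyshev Finset

/-- A real Chebyshev polynomial, cast into `𝕜 = ℝ` or `ℂ`, has norm at most one on `[-1, 1]`. -/
theorem norm_cast_eval_T_le_one {𝕜 : Type*} [RCLike 𝕜] (m : ℕ) {x : ℝ} (hx : |x| ≤ 1) :
    ‖(((T ℝ m).eval x : ℝ) : 𝕜)‖ ≤ 1 := by
  rw [RCLike.norm_ofReal]
  exact abs_eval_T_real_le_one (m : ℤ) hx

/-- CHEBYSHEV ENVELOPE: `‖Σ_{m<N} c_m T_m(x)‖ ≤ Σ_{m<N} ‖c_m‖` for `|x| ≤ 1`. -/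
theorem chebyshevEnvelope_sum_le {𝕜 : Type*} [RCLike 𝕜] (c : ℕ → 𝕜) (N : ℕ) {x : ℝ}
    (hx : |x| ≤ 1) :
    ‖∑ m ∈ range N, c m * (((T ℝ m).eval x : ℝ) : 𝕜)‖ ≤ ∑ m ∈ range N, ‖c m‖ := by
  refine (norm_sum_le _ _).trans (sum_le_sum fun m _ => ?_)
  rw [norm_mul]
  calc ‖c m‖ * ‖(((T ℝ m).eval x : ℝ) : 𝕜)‖ ≤ ‖c m‖ * 1 := by
        gcongr
        exact norm_cast_eval_T_le_one m hx
    _ = ‖c m‖ := mul_one _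

/-- Chebyshev envelope with a remainder / transported-error term `R`, `‖R‖ ≤ r`. -/
theorem chebyshevEnvelope_le {𝕜 : Type*} [RCLike 𝕜] (c : ℕ → 𝕜) (N : ℕ) {x : ℝ}
    (hx : |x| ≤ 1) {R : 𝕜} {r : ℝ} (hR : ‖R‖ ≤ r) :
    ‖∑ m ∈ range N, c m * (((T ℝ m).eval x : ℝ) : 𝕜) + R‖ ≤ ∑ m ∈ range N, ‖c m‖ + r :=
  (norm_add_le _ _).trans (add_le_add (chebyshevEnvelope_sum_le c N hx) hR)

/-- The box form: for `0 < s` and `|P - P_c| ≤ s` the reduced variable `x = (P - P_c)/s` lies in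
`[-1, 1]`, so the envelope holds uniformly on the parameter box. -/
theorem chebyshevEnvelope_box_le {𝕜 : Type*} [RCLike 𝕜] (c : ℕ → 𝕜) (N : ℕ) {P Pc s : ℝ}
    (hs : 0 < s) (hP : |P - Pc| ≤ s) {R : 𝕜} {r : ℝ} (hR : ‖R‖ ≤ r) :
    ‖∑ m ∈ range N, c m * (((T ℝ m).eval ((P - Pc) / s) : ℝ) : 𝕜) + R‖ ≤
      ∑ m ∈ range N, ‖c m‖ + r := by
  have hx : |(P - Pc) / s| ≤ 1 := by
    rw [abs_div, abs_of_pos hs, div_le_one hs]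
    exact hP
  exact chebyshevEnvelope_le c N hx hR

end Summit.AnomalousDissipation.AnomalousDissipation.Theorems
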